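import Literature.AlgebraicGeometry.Frobenioids.CategoriesFactorizationRevised
import Mathlib.CategoryTheory.Category.Preorder
import Mathlib.Order.Fin.Basic
import HarnessLib

/-!
# Frobenioids I, §0: a category of FSMFF-type (revised 2024 sense) which is NOT of FSM-type — the walking arrow

Mochizuki, *The geometry of Frobenioids I: the general theory*, Kyushu J. Math. **62** (2008) 293–400, §0
"Categories", kurims text pp. 14, 17–18 ("Thus, if `C` is of FSM-type, then it is of FSMFF-type")
[cite: MochizukiFrdI2008, §0 p.18], with condition (b) of "FSMFF-type" as revised by the author's
*Comments* (January 2024), item (28) [cite: MochizukiFrdIComments2024, (28) p.3].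

PROOF-ONLY file (no definitions; seat abc-iut-w4-d093). `FSMFFType2024Instances.lean` records that every base
category the tree proves to be of FSMFF-type (2024) reaches it through "FSM-type ⇒ FSMFF-type". This file
supplies a kernel witness that the revised class is STRICTLY larger: the walking arrow — the preorder category
`Fin 2`, one non-identity arrow `0 ⟶ 1` — is of FSMFF-type in the revised sense (its unique FSMI-morphism is
`0 ⟶ 1`; bound `N = 2` in condition (b)) but is not of FSM-type (`0 ⟶ 1` is a non-invertible FSM-morphism):
`WalkingArrow.exists_isOfFSMFFType2024_not_isOfFSMType`. Hence statements proved over bases of FSMFF-type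
(2024) — e.g. [FrdI] Thm. 3.4 (iii)–(v) as typed (`FrdI.thm34iii_ofFunctor_of_isOfFSMFFType2024`) — are not
mere restatements of their FSM-type versions. Nothing here is a claim of the paper beyond §0's definitions;
nothing bears on [IUTchIII].
-/

namespace Literature.AlgebraicGeometry.Frobenioids

namespace WalkingArrow

open CategoryTheory

/-- In the preorder category `Fin 2` an arrow is an isomorphism iff its source and target coincide.
[cite: MochizukiFrdI2008, §0 p.14] -/
theorem isIso_iff_eq {a b : Fin 2} (f : a ⟶ b) : IsIso f ↔ a = b := by
  constructor
  · intro h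
    exact le_antisymm (leOfHom f) (leOfHom (inv f))
  · rintro rfl
    rw [show f = 𝟙 a from Subsingleton.elim _ _]
    infer_instance

/-- The arrow `0 ⟶ 1` of `Fin 2` is not an isomorphism. [cite: MochizukiFrdI2008, §0 p.14] -/
theorem not_isIso_arrow : ¬ IsIso (homOfLE (Fin.zero_le (1 : Fin 2)) : (0 : Fin 2) ⟶ 1) := fun h =>
  absurd (((isIso_iff_eq _).1 h)) (by decide)

/-- The arrow `0 ⟶ 1` of `Fin 2` is an FSM-morphism: it is fiberwise-surjective (every arrow into `1`
lifts along it through `0`) and a monomorphism (the category is thin). [cite: MochizukiFrdI2008, §0 p.14] -/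
theorem isFSM_arrow : IsFSM (homOfLE (Fin.zero_le (1 : Fin 2)) : (0 : Fin 2) ⟶ 1) := by
  refine ⟨fun X γ => ?_, ⟨fun _ _ _ => Subsingleton.elim _ _⟩⟩
  exact ⟨0, 𝟙 _, homOfLE (Fin.zero_le _), Subsingleton.elim _ _⟩

/-- The arrow `0 ⟶ 1` of `Fin 2` is an FSMI-morphism (irreducible: in any factorisation `0 ⟶ X ⟶ 1` one
factor is an identity). [cite: MochizukiFrdI2008, §0 p.17] -/
theorem isFSMI_arrow : IsFSMI (homOfLE (Fin.zero_le (1 : Fin 2)) : (0 : Fin 2) ⟶ 1) := by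
  refine ⟨isFSM_arrow, not_isIso_arrow, fun X β α _ => ?_⟩
  rcases (show X = 0 ∨ X = 1 by omega) with rfl | rfl
  · exact Or.inr ((isIso_iff_eq β).2 rfl)
  · exact Or.inl ((isIso_iff_eq α).2 rfl)

/-- **The walking arrow is not of FSM-type** (an FSM-morphism which is not an isomorphism exists).
[cite: MochizukiFrdI2008, §0 p.14] -/
theorem not_isOfFSMType : ¬ IsOfFSMType (Fin 2) := fun h =>
  not_isIso_arrow (h.isIso_of_isFSM _ isFSM_arrow)

/-- An FSMI-morphism of `Fin 2` goes from `0` to `1`. [cite: MochizukiFrdI2008, §0 p.17] -/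
theorem eq_of_isFSMI {a b : Fin 2} (f : a ⟶ b) (hf : IsFSMI f) : a = 0 ∧ b = 1 := by
  have hne : a ≠ b := fun h => hf.2.1 ((isIso_iff_eq f).2 h)
  have hle : a ≤ b := leOfHom f
  omega

/-- A composite of FSMI-morphisms in `Fin 2` has length one and goes from `0` to `1`.
[cite: MochizukiFrdI2008, §0 p.17] -/
theorem isFSMIChain_length {a b : Fin 2} (f : a ⟶ b) (n : ℕ) (h : IsFSMIChain f n) :
    n = 1 ∧ a = 0 ∧ b = 1 := by
  induction h with
  | single φ hφ => exact ⟨rfl, eq_of_isFSMI φ hφ⟩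
  | cons ψ χ m hψ _ ih =>
    obtain ⟨-, hX0, -⟩ := ih
    obtain ⟨-, hX1⟩ := eq_of_isFSMI ψ hψ
    omega

/-- **The walking arrow is of FSMFF-type in the author's revised (2024) sense**: (a) the only non-invertible
FSM-morphism `0 ⟶ 1` is itself FSMI; (b) a composite with arbitrary head and FSMI tail out of any object has
length at most `2`. [cite: MochizukiFrdIComments2024, (28) p.3] -/
theorem isOfFSMFFType2024 : IsOfFSMFFType2024 (Fin 2) where
  factors φ hφ hφ' := by
    refine ⟨1, IsFSMIChain.single φ ⟨hφ, hφ', fun X β α _ => ?_⟩⟩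
    by_cases hX : IsIso β
    · exact Or.inr hX
    · left
      rw [isIso_iff_eq] at hX ⊢
      have h1 := leOfHom β; have h2 := leOfHom α; have h3 := leOfHom φ
      have hne : _ := fun h => hφ' ((isIso_iff_eq φ).2 h)
      omega
  bounded A := ⟨2, fun φ n h => by
    cases h with
    | single _ _ => omega
    | comp φ₁ χ m _ hχ =>
      obtain ⟨hm, -, -⟩ := isFSMIChain_length χ m hχ
      omega⟩

/-- In particular the walking arrow is of FSMFF-type in the printed (2008) sense as well.
[cite: MochizukiFrdI2008, §0 p.17] -/
theorem isOfFSMFFType : IsOfFSMFFType (Fin 2) := isOfFSMFFType2024.isOfFSMFFType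

/-- **Witness: the class "FSMFF-type (2024)" is strictly larger than "FSM-type".**
[cite: MochizukiFrdIComments2024, (28) p.3] -/
theorem exists_isOfFSMFFType2024_not_isOfFSMType :
    ∃ (D : Type) (_ : Category.{0} D), IsOfFSMFFType2024 D ∧ ¬ IsOfFSMType D :=
  ⟨Fin 2, inferInstance, isOfFSMFFType2024, not_isOfFSMType⟩

end WalkingArrow

end Literature.AlgebraicGeometry.Frobenioids
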